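import Literature.NumberTheory.GaloisRepresentations.FrobeniusQuotientHOne
import Literature.NumberTheory.GaloisRepresentations.PadicIntCdOne
import HarnessLib

/-!
# `H¹(G / ker φ, D) = 0` forces `D = (γ − 1) D` for a `ℤ_p`-quotient `φ : G ↠ ℤ_p` (Serre, *Corps locaux* XIII §1)

Topic `NumberTheory/GaloisRepresentations`; namespace `Literature.NumberTheory.GaloisRepresentations`.
Theorems only (no definition, no named fact; D-0026).

Let `G` be a compact topological group, `φ : G →ₜ* ℤ_p` a continuous SURJECTIVE homomorphism (written
multiplicatively), `N ⊴ G` a normal subgroup with `N = ker φ` (given as the membership equivalence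
`g ∈ N ↔ φ g = 1`, so that any spelling of the kernel may be used, e.g. the tree's
`ZpExtension.kerSubgroup`), `γ ∈ G` with `φ γ = 1 ∈ ℤ_p` (a topological generator of `G / N ≅ ℤ_p`),
and `D` a discrete `p`-primary `G / N`-module (`ContinuousRep (G ⧸ N) ℤ D`).  The classical
computation `H¹(ℤ_p, D) ≅ D / (γ − 1) D`, `[z] ↦ z(γ)` (Serre, *Corps locaux*, XIII §1 Prop. 1 for
`Ẑ`; for `ℤ_p` and `p`-primary `D` the same proof: a class is inflated from a finite cyclic quotient
`ℤ/p^m`, and `b ↦ (σ ↦ Σ_{j < idx σ} γʲ b)` is a cocycle as soon as the norm `Σ_{j<p^m} γʲ b`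
vanishes, which holds for `m` large because `b` is killed by a power of `p` and fixed by a power
`γ^{p^n}`) gives in particular:

* `exists_apply_sub_eq_of_subsingleton_one` — **if `H¹(G / N, D) = 0` then every `d ∈ D` is of the
  form `γ · v − v`**, i.e. `D = (γ − 1) D`: the coinvariants `D_Γ` vanish.

This is the step «`H¹(Γ, H) = 0 ⟹ H_Γ = H / (γ − 1) H = 0`» of the Iwasawa-theoretic use of the
Hochschild–Serre edge `H¹(Γ, H¹(K_∞, A)) ↪ H²(K, A)` (Greenberg, LNM 1716, §4, Appendix, pp. 116–117:
`H¹(F_Σ/F, 𝒜)/θ_s ↪ H²(F_Σ/F, 𝒜[θ_s])`), companion file `ZpExtensionCoinvariantsResTwo.lean`.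

Auxiliary public lemmas on the layer subgroups `L_m = φ⁻¹(p^m ℤ_p)` (all elementary, Washington
§13.1): `ker φ ≤ L_m`; `γ^k ∈ L_m ↔ p^m ∣ k`; every coset of `L_m` is `γ^i L_m`; the class of `γ` in
`G ⧸ L_m` has order `p^m`; `G ⧸ L_m` is finite; an open subgroup containing `ker φ` contains some `L_n`
(the open-mapping property of the quotient map `φ`, by compactness); and the geometric-sum identity
`S(a k) = k • S(a)` when `γᵃ` fixes the base point.

## References
* J.-P. Serre, *Corps locaux* / *Local Fields* (1979), XIII §1 Prop. 1. [SerreLocalFields1979]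
* J.-P. Serre, *Cohomologie galoisienne* (1997), I §3.4 (`cd_p(ℤ_p) = 1`). [SerreGaloisCohomology1997]
* L. Washington, *Introduction to Cyclotomic Fields* (1997), §13.1. [Washington1997]
* R. Greenberg, *Iwasawa theory for elliptic curves*, LNM 1716 (1999), §4 Appendix pp. 116–117.
  [GreenbergLNM1716]
-/

noncomputable section

open CategoryTheory Function
open _root_.TopRep _root_.ContinuousCohomology _root_.Topology _root_.Filter

universe u v

namespace Literature.NumberTheory.GaloisRepresentations

/-! ### Geometric sums with a base point fixed by a power -/

section Geom

variable {R : Type u} [CommRing R] [TopologicalSpace R]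
variable {G : Type v} [Group G] [TopologicalSpace G] [IsTopologicalGroup G]
variable {X : TopRep.{v} R G} (F : G) (b₀ : X)

omit [TopologicalSpace G] [IsTopologicalGroup G] in
/-- If `g` fixes `b₀` then so does every power `g^k`. [folklore] -/
private theorem apply_pow_eq_self_of_apply_eq {g : G} (hg : X.ρ g b₀ = b₀) (k : ℕ) : X.ρ (g ^ k) b₀ = b₀ := by
  induction k with
  | zero => rw [pow_zero, map_one]; rfl
  | succ k ih => rw [pow_succ, map_mul, mul_apply_eq_comp, hg, ih]

omit [TopologicalSpace G] [IsTopologicalGroup G] in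
/-- If `Fᵃ` fixes `b₀` then it fixes every geometric sum `S(i) = Σ_{j<i} Fʲ b₀` (powers of `F`
commute). [cite: SerreLocalFields1979, XIII §1] -/
theorem apply_pow_geomSum_of_apply_eq {a : ℕ} (ha : X.ρ (F ^ a) b₀ = b₀) (i : ℕ) :
    X.ρ (F ^ a) (geomSum F b₀ i) = geomSum F b₀ i := by
  induction i with
  | zero => rw [geomSum_zero, map_zero]
  | succ i ih =>
    rw [geomSum_succ, map_add, ih]
    congr 1
    rw [← mul_apply_eq_comp, ← map_mul, ← pow_add, add_comm, pow_add, map_mul, mul_apply_eq_comp, ha]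

omit [TopologicalSpace G] [IsTopologicalGroup G] in
/-- `S(a k) = k • S(a)` as soon as `Fᵃ` fixes the base point `b₀` (compare the tree's
`geomSum_mul_eq_smul`, which asks `Fᵃ` to act trivially on the whole module). [cite: SerreLocalFields1979, XIII §1] -/
theorem geomSum_mul_eq_smul_of_apply_eq {a : ℕ} (ha : X.ρ (F ^ a) b₀ = b₀) (k : ℕ) :
    geomSum F b₀ (a * k) = k • geomSum F b₀ a := by
  induction k with
  | zero => rw [mul_zero, geomSum_zero, zero_smul]
  | succ k ih =>
    have hak : X.ρ (F ^ (a * k)) b₀ = b₀ := by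
      rw [pow_mul]; exact apply_pow_eq_self_of_apply_eq b₀ ha k
    rw [Nat.mul_succ, geomSum_add, apply_pow_geomSum_of_apply_eq F b₀ hak, ih, succ_nsmul]

omit [TopologicalSpace G] [IsTopologicalGroup G] in
/-- `n • S(i) = Σ_{j<i} Fʲ (n • b₀)`; in particular `n • S(i) = 0` if `n • b₀ = 0`. [folklore] -/
private theorem nsmul_geomSum_eq_zero {n : ℕ} (hn : n • b₀ = 0) (i : ℕ) : n • geomSum F b₀ i = 0 := by
  induction i with
  | zero => rw [geomSum_zero, smul_zero]
  | succ i ih => rw [geomSum_succ, smul_add, ih, zero_add, ← map_nsmul, hn, map_zero]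

end Geom

/-! ### The layer subgroups `φ⁻¹(p^m ℤ_p)` of a `ℤ_p`-quotient -/

section Layer

variable {G : Type u} [Group G] [TopologicalSpace G] {p : ℕ} [hp : Fact p.Prime]
  (φ : G →ₜ* Multiplicative ℤ_[p])

omit [TopologicalSpace G] in
/-- `p^m ∣ (k : ℤ_p)` iff `p^m ∣ k` in `ℕ`. [folklore] -/
private theorem pow_dvd_natCast_padicInt_iff (m k : ℕ) :
    (p : ℤ_[p]) ^ m ∣ (k : ℤ_[p]) ↔ p ^ m ∣ k := by
  rw [← Ideal.mem_span_singleton, ← PadicInt.norm_le_pow_iff_mem_span_pow,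
    show ((k : ℤ_[p]) : ℤ_[p]) = ((k : ℤ) : ℤ_[p]) by push_cast; rfl, PadicInt.norm_int_le_pow_iff_dvd]
  exact_mod_cast Int.natCast_dvd_natCast

/-- `ker φ ≤ φ⁻¹(p^m ℤ_p)`. [cite: Washington1997, §13.1] -/
theorem ker_le_comap_span_pow' (m : ℕ) :
    φ.toMonoidHom.ker ≤
      (AddSubgroup.toSubgroup (Ideal.span {(p : ℤ_[p]) ^ m}).toAddSubgroup).comap φ.toMonoidHom := by
  intro σ hσ
  rw [mem_comap_span_pow_iff]
  have h1 : φ σ = 1 := hσ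
  rw [h1, toAdd_one]
  exact dvd_zero _

/-- For a subgroup `L` with `σ ∈ L ↔ p^m ∣ φ σ` (i.e. `L = φ⁻¹(p^m ℤ_p)`, in any spelling) and
`φ γ = 1 ∈ ℤ_p`: `γ^k ∈ L ↔ p^m ∣ k`. [cite: Washington1997, §13.1] -/
theorem pow_mem_iff_of_mem_iff {γ : G} (hγ : φ γ = Multiplicative.ofAdd 1) {m : ℕ} (L : Subgroup G)
    (hL : ∀ σ : G, σ ∈ L ↔ (p : ℤ_[p]) ^ m ∣ (φ σ).toAdd) (k : ℕ) : γ ^ k ∈ L ↔ p ^ m ∣ k := by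
  rw [hL, map_pow, hγ, ← ofAdd_nsmul, toAdd_ofAdd, nsmul_eq_mul, mul_one]
  exact pow_dvd_natCast_padicInt_iff m k

/-- Every coset of `L = φ⁻¹(p^m ℤ_p)` is `γ^i · L` for some `i : ℕ` (`φ γ = 1`): the `p`-adic integer
`φ σ` is congruent to the natural number `appr (φ σ) m` modulo `p^m`.
[cite: Washington1997, §13.1] [cite: SerreGaloisCohomology1997, I §3.4] -/
theorem exists_mk_eq_mk_pow {γ : G} (hγ : φ γ = Multiplicative.ofAdd 1) {m : ℕ} (L : Subgroup G) [L.Normal]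
    (hL : ∀ σ : G, σ ∈ L ↔ (p : ℤ_[p]) ^ m ∣ (φ σ).toAdd) (q : G ⧸ L) :
    ∃ i : ℕ, q = (QuotientGroup.mk γ : G ⧸ L) ^ i := by
  obtain ⟨σ, rfl⟩ := QuotientGroup.mk_surjective q
  refine ⟨PadicInt.appr (φ σ).toAdd m, ?_⟩
  rw [← QuotientGroup.mk_pow, eq_comm, QuotientGroup.eq]
  rw [hL, map_mul, map_inv, map_pow, hγ, toAdd_mul, toAdd_inv, toAdd_pow,
    toAdd_ofAdd, nsmul_eq_mul, mul_one, ← Ideal.mem_span_singleton]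
  have h := PadicInt.appr_spec m (φ σ).toAdd
  have heq : -((PadicInt.appr (φ σ).toAdd m : ℕ) : ℤ_[p]) + (φ σ).toAdd =
      (φ σ).toAdd - (PadicInt.appr (φ σ).toAdd m : ℕ) := by ring
  rw [heq]
  exact h

/-- The class of `γ` in `G ⧸ L`, `L = φ⁻¹(p^m ℤ_p)`, has order `p^m` (`φ γ = 1`). [cite: Washington1997, §13.1] -/
theorem orderOf_mk_eq_pow {γ : G} (hγ : φ γ = Multiplicative.ofAdd 1) {m : ℕ} (L : Subgroup G) [L.Normal]
    (hL : ∀ σ : G, σ ∈ L ↔ (p : ℤ_[p]) ^ m ∣ (φ σ).toAdd) :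
    orderOf (QuotientGroup.mk γ : G ⧸ L) = p ^ m := by
  refine (orderOf_eq_iff (pow_pos hp.out.pos m)).2 ⟨?_, fun k hk hk0 h => ?_⟩
  · rw [← QuotientGroup.mk_pow, QuotientGroup.eq_one_iff, pow_mem_iff_of_mem_iff φ hγ L hL]
  · rw [← QuotientGroup.mk_pow, QuotientGroup.eq_one_iff, pow_mem_iff_of_mem_iff φ hγ L hL] at h
    exact absurd (Nat.le_of_dvd hk0 h) (not_le.mpr hk)

/-- `G ⧸ L`, `L = φ⁻¹(p^m ℤ_p)`, is finite (every class is a power `γ̄^i`, `i < p^m`). [cite: Washington1997, §13.1] -/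
theorem finite_quotient_of_mem_iff {γ : G} (hγ : φ γ = Multiplicative.ofAdd 1) {m : ℕ} (L : Subgroup G)
    [L.Normal] (hL : ∀ σ : G, σ ∈ L ↔ (p : ℤ_[p]) ^ m ∣ (φ σ).toAdd) : Finite (G ⧸ L) := by
  refine Finite.of_surjective (fun i : Fin (p ^ m) => (QuotientGroup.mk γ : G ⧸ L) ^ (i : ℕ)) fun q => ?_
  obtain ⟨i, hi⟩ := exists_mk_eq_mk_pow φ hγ L hL q
  refine ⟨⟨i % p ^ m, Nat.mod_lt _ (pow_pos hp.out.pos m)⟩, ?_⟩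
  change (QuotientGroup.mk γ : G ⧸ L) ^ (i % p ^ m) = q
  rw [hi, ← orderOf_mk_eq_pow φ hγ L hL, pow_mod_orderOf]

variable [CompactSpace G]

/-- **An open subgroup of `G` containing `ker φ` contains a layer subgroup `φ⁻¹(p^n ℤ_p)`** (`φ`
surjective, `G` compact): `φ` is a closed continuous surjection, hence a quotient map, so the image of
the saturated open set `S` is an open neighbourhood of `0` in `ℤ_p` and contains some `p^n ℤ_p`.
[cite: Washington1997, §13.1] [cite: SerreGaloisCohomology1997, I §3.4] -/
theorem exists_comap_span_pow_le_of_isOpen (hφ : Surjective φ) (S : Subgroup G) (hS : IsOpen (S : Set G))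
    (hker : φ.toMonoidHom.ker ≤ S) :
    ∃ n : ℕ, (AddSubgroup.toSubgroup (Ideal.span {(p : ℤ_[p]) ^ n}).toAddSubgroup).comap φ.toMonoidHom ≤ S := by
  classical
  have hquot : IsQuotientMap (φ : G → Multiplicative ℤ_[p]) :=
    (map_continuous φ).isClosedMap.isQuotientMap (map_continuous φ) hφ
  have himg_open : IsOpen ((φ : G → Multiplicative ℤ_[p]) '' (S : Set G)) := by
    rw [← hquot.isOpen_preimage]
    have hsat : (φ : G → Multiplicative ℤ_[p]) ⁻¹' ((φ : G → Multiplicative ℤ_[p]) '' (S : Set G)) =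
        (S : Set G) := by
      ext σ
      constructor
      · rintro ⟨τ, hτ, hτσ⟩
        have hmem : τ⁻¹ * σ ∈ φ.toMonoidHom.ker := by
          rw [MonoidHom.mem_ker, map_mul, map_inv]
          change (φ τ)⁻¹ * φ σ = 1
          rw [hτσ, inv_mul_cancel]
        have h2 := S.mul_mem hτ (hker hmem)
        rwa [mul_inv_cancel_left] at h2
      · intro hσ
        exact ⟨σ, hσ, rfl⟩
    rw [hsat]
    exact hS
  have hmem0 : (0 : ℤ_[p]) ∈ Multiplicative.toAdd '' ((φ : G → Multiplicative ℤ_[p]) '' (S : Set G)) :=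
    ⟨1, ⟨1, S.one_mem, map_one φ⟩, rfl⟩
  have himg_open' : IsOpen (Multiplicative.toAdd '' ((φ : G → Multiplicative ℤ_[p]) '' (S : Set G))) := by
    rw [Set.image_eq_preimage_of_inverse (f := (Multiplicative.toAdd : Multiplicative ℤ_[p] → ℤ_[p]))
      (g := Multiplicative.ofAdd) (fun _ => rfl) (fun _ => rfl)]
    exact himg_open.preimage continuous_ofAdd
  -- a ball `p^n ℤ_p` inside the open neighbourhood of `0`
  obtain ⟨ε, hε, hball⟩ := Metric.isOpen_iff.1 himg_open' 0 hmem0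
  obtain ⟨n, hn⟩ := PadicInt.exists_pow_neg_lt p hε
  refine ⟨n, fun σ hσ => ?_⟩
  rw [mem_comap_span_pow_iff, ← Ideal.mem_span_singleton, ← PadicInt.norm_le_pow_iff_mem_span_pow] at hσ
  have hσball : (φ σ).toAdd ∈ Metric.ball (0 : ℤ_[p]) ε := by
    rw [Metric.mem_ball, dist_zero_right]
    exact lt_of_le_of_lt hσ hn
  obtain ⟨y, ⟨τ, hτ, hτy⟩, hy⟩ := hball hσball
  have hφeq : φ τ = φ σ := by
    rw [← ofAdd_toAdd (φ τ), ← ofAdd_toAdd (φ σ)]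
    exact congrArg Multiplicative.ofAdd (by rw [← hy, hτy])
  have hmem : τ⁻¹ * σ ∈ φ.toMonoidHom.ker := by
    rw [MonoidHom.mem_ker, map_mul, map_inv]
    change (φ τ)⁻¹ * φ σ = 1
    rw [hφeq, inv_mul_cancel]
  have h2 := S.mul_mem hτ (hker hmem)
  rwa [mul_inv_cancel_left] at h2

end Layer

/-! ### `H¹(G / ker φ, D) = 0 ⟹ D = (γ − 1) D` -/

section Coinvariants

variable {G : Type u} [Group G] [TopologicalSpace G] [IsTopologicalGroup G] [CompactSpace G]
  {p : ℕ} [hp : Fact p.Prime] (φ : G →ₜ* Multiplicative ℤ_[p])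
variable (N : Subgroup G) [N.Normal]
variable {D : Type u} [AddCommGroup D] [TopologicalSpace D] [DiscreteTopology D]
  (τ : ContinuousRep (G ⧸ N) ℤ D)

/-- **`H¹(G / N, D) = 0` forces `D = (γ − 1) D`** (Serre, *Corps locaux* XIII §1 Prop. 1, the
`ℤ_p`-case, vanishing direction). Here `φ : G ↠ ℤ_p` is a continuous surjection from a compact group,
`N = ker φ` (membership equivalence), `φ γ = 1 ∈ ℤ_p`, and `D` is a discrete `G / N`-module every element
of which is killed by a power of `p`: if `H¹(G / N, D) = 0` then for every `d ∈ D` there is `v ∈ D` with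
`γ̄ v − v = d`. Proof: `d` is fixed by some layer `L_n = φ⁻¹(p^n ℤ_p)` and killed by `p^e`; with
`m = n + e` the norm `Σ_{j<p^m} γʲ d = p^e • Σ_{j<p^n} γʲ d = 0` vanishes, so the geometric cocycle
`σ ↦ Σ_{j<idx σ} γʲ d` of the cyclic quotient `G ⧸ L_m = ⟨γ̄⟩` (order `p^m`) is a continuous cocycle
of `G` with values in `D^{L_m}`, vanishing on `L_m ⊇ N`; it descends to `G / N`, where its class is
`0` by hypothesis, i.e. it is the coboundary of some `v`, and its value at `γ` is `d`.
[cite: SerreLocalFields1979, XIII §1 Prop. 1] [cite: GreenbergLNM1716, §4 Appendix pp. 116–117] -/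
theorem exists_apply_sub_eq_of_subsingleton_one (hφ : Surjective φ)
    (hN : ∀ g : G, g ∈ N ↔ φ g = 1) {γ : G} (hγ : φ γ = Multiplicative.ofAdd 1)
    (hD : ∀ d : D, ∃ e : ℕ, p ^ e • d = 0)
    [Subsingleton (continuousCohomology 1 τ.toTopRep)] (d : D) :
    ∃ v : D, τ (QuotientGroup.mk γ) v - v = d := by
  classical
  -- `D` as a `G`-module through `G → G / N`
  let τG : ContinuousRep G ℤ D := τ.restrict (ContinuousMonoidHom.quotientMk N)
  have hτG : ∀ g : G, τG g = τ (QuotientGroup.mk g) := fun g => rfl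
  have hτGN : ∀ g ∈ N, ∀ x : D, τG g x = x := fun g hg x => by
    rw [hτG, (QuotientGroup.eq_one_iff g).mpr hg, map_one]; rfl
  have hkerN : φ.toMonoidHom.ker ≤ N := fun g hg => (hN g).mpr hg
  -- the stabiliser of `d`: an open subgroup containing `ker φ`, hence containing a layer `L_n`
  let S : Subgroup G :=
    { carrier := {g | τG g d = d}
      one_mem' := by change τG 1 d = d; rw [map_one]; rfl
      mul_mem' := fun {a b} ha hb => by
        change τG (a * b) d = d
        rw [map_mul, Module.End.mul_apply, show τG b d = d from hb, show τG a d = d from ha]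
      inv_mem' := fun {a} ha => by
        change τG a⁻¹ d = d
        have h : τG a⁻¹ (τG a d) = d := by
          rw [← Module.End.mul_apply, ← map_mul, inv_mul_cancel, map_one]; rfl
        rwa [show τG a d = d from ha] at h }
  have hSopen : IsOpen (S : Set G) := τG.isOpen_setOf_apply_eq d
  have hkerS : φ.toMonoidHom.ker ≤ S := fun g hg => hτGN g (hkerN hg) d
  obtain ⟨n, hn⟩ := exists_comap_span_pow_le_of_isOpen φ hφ S hSopen hkerS
  obtain ⟨e, he⟩ := hD d
  -- the layer `L = L_{n+e}`: open, normal, `N ≤ L ≤ L_n ≤ S`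
  let L : Subgroup G :=
    (AddSubgroup.toSubgroup (Ideal.span {(p : ℤ_[p]) ^ (n + e)}).toAddSubgroup).comap φ.toMonoidHom
  have hLmem : ∀ σ : G, σ ∈ L ↔ (p : ℤ_[p]) ^ (n + e) ∣ (φ σ).toAdd := fun σ =>
    mem_comap_span_pow_iff φ (n + e) σ
  haveI hLn : L.Normal := Subgroup.Normal.comap inferInstance _
  have hLopen : IsOpen (L : Set G) := isOpen_comap_span_pow φ (n + e)
  have hLS : L ≤ S := by
    intro σ hσ
    refine hn ?_
    rw [mem_comap_span_pow_iff]
    rw [hLmem] at hσ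
    exact (pow_dvd_pow _ (Nat.le_add_right n e)).trans hσ
  have hNL : N ≤ L := fun g hg => ker_le_comap_span_pow' φ (n + e) ((hN g).mp hg)
  haveI : Finite (G ⧸ L) := finite_quotient_of_mem_iff φ hγ L hLmem
  -- the `G`-module `D^L` (on which `L` acts trivially)
  let W : Submodule ℤ D := τG.invariantsOf L
  have hdW : d ∈ W := fun l => hLS l.2
  let τW : ContinuousRep G ℤ W :=
    τG.subrepresentation W (Representation.le_comap_invariants τG.toRepresentation L)
  let X : TopRep ℤ G := τW.toTopRep
  have hXρ : ∀ (g : G) (w : W), ((X.ρ g w : W) : D) = τG g w := fun g w => rfl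
  let b₀ : W := ⟨d, hdW⟩
  have hH : ∀ h ∈ L, ∀ x : X, X.ρ h x = x := fun h hh x =>
    Subtype.ext (by rw [hXρ]; exact x.2 ⟨h, hh⟩)
  have hgen : ∀ q : G ⧸ L, ∃ i : ℕ, q = (QuotientGroup.mk γ : G ⧸ L) ^ i := fun q =>
    exists_mk_eq_mk_pow φ hγ L hLmem q
  -- the norm vanishes: `S(p^{n+e}) = p^e • S(p^n) = 0`
  have hγn : X.ρ (γ ^ p ^ n) b₀ = b₀ := by
    refine Subtype.ext ?_
    rw [hXρ]
    have hmem : γ ^ p ^ n ∈ S :=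
      hn ((pow_mem_iff_of_mem_iff φ hγ _ (fun σ => mem_comap_span_pow_iff φ n σ) (p ^ n)).2 dvd_rfl)
    exact hmem
  have hb₀e : p ^ e • b₀ = 0 := Subtype.ext (by
    rw [Submodule.coe_smul_of_tower, Submodule.coe_zero]; exact he)
  have hord : orderOf (QuotientGroup.mk γ : G ⧸ L) = p ^ (n + e) := orderOf_mk_eq_pow φ hγ L hLmem
  have hNsum : geomSum γ b₀ (orderOf (QuotientGroup.mk γ : G ⧸ L)) = (0 : X) := by
    rw [hord, pow_add, geomSum_mul_eq_smul_of_apply_eq (X := X) γ b₀ hγn]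
    exact nsmul_geomSum_eq_zero (X := X) γ b₀ hb₀e (p ^ n)
  -- the geometric cocycle of `G` with values in `D^L`
  let z : contOneCocycles X := geomCocycle (X := X) γ b₀ L hgen hLopen hH hNsum
  have hzγ : z.1 γ = b₀ := geomCocycle_apply_self (X := X) γ b₀ L hgen hLopen hH hNsum
  have hzL : ∀ l ∈ L, z.1 l = 0 := fun l hl => by
    change geomSum (X := X) γ b₀ (idxQ L γ hgen (l : G ⧸ L)) = 0
    have h1 : (QuotientGroup.mk γ : G ⧸ L) ^ idxQ L γ hgen (l : G ⧸ L) = 1 := by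
      rw [← idxQ_spec L γ hgen (l : G ⧸ L)]
      exact (QuotientGroup.eq_one_iff l).mpr hl
    have hmod : idxQ L γ hgen (l : G ⧸ L) ≡ 0 [MOD orderOf (QuotientGroup.mk γ : G ⧸ L)] :=
      (Nat.modEq_zero_iff_dvd).2 (orderOf_dvd_of_pow_eq_one h1)
    rw [geomSum_eq_of_modEq (X := X) γ b₀ hNsum hmod, geomSum_zero]
  -- push to `D` and descend to `G / N`
  let zD : G → D := fun g => ((z.1 g : W) : D)
  have hzD_cont : Continuous zD := continuous_subtype_val.comp z.1.continuous
  have hzD_mul : ∀ a b : G, zD (a * b) = zD a + τG a (zD b) := fun a b => by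
    change (((z.1 (a * b)) : W) : D) = ((z.1 a : W) : D) + τG a ((z.1 b : W) : D)
    rw [z.2 a b, Submodule.coe_add, hXρ]
  have hzD_N : ∀ g ∈ N, zD g = 0 := fun g hg => by
    change ((z.1 g : W) : D) = 0
    rw [hzL g (hNL hg), Submodule.coe_zero]
  have hzD_wd : ∀ a b : G, (QuotientGroup.mk a : G ⧸ N) = QuotientGroup.mk b → zD a = zD b := by
    intro a b hab
    have hmem : a⁻¹ * b ∈ N := QuotientGroup.eq.1 hab
    have h := hzD_mul a (a⁻¹ * b)
    rw [mul_inv_cancel_left, hzD_N _ hmem, map_zero, add_zero] at h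
    exact h.symm
  let zQf : G ⧸ N → D := Quotient.lift zD fun a b hab => hzD_wd a b (Quotient.sound hab)
  have hzQf_mk : ∀ g : G, zQf (QuotientGroup.mk g) = zD g := fun g => rfl
  have hzQf_cont : Continuous zQf := by
    rw [(QuotientGroup.isQuotientMap_mk N).continuous_iff]
    exact hzD_cont
  let zQ : contOneCocycles τ.toTopRep :=
    ⟨⟨zQf, hzQf_cont⟩, fun a b => by
      induction a using QuotientGroup.induction_on with
      | H a =>
        induction b using QuotientGroup.induction_on with
        | H b =>
          change zQf (QuotientGroup.mk (a * b)) = zQf (QuotientGroup.mk a) + τ (QuotientGroup.mk a) (zQf (QuotientGroup.mk b))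
          rw [hzQf_mk, hzQf_mk, hzQf_mk, hzD_mul, hτG]⟩
  -- its class vanishes: it is a coboundary
  have h0 : oneCocycleClass τ.toTopRep zQ = 0 := Subsingleton.elim _ _
  obtain ⟨v, hv⟩ := (oneCocycleClass_eq_zero_iff τ.toTopRep zQ).1 h0
  refine ⟨v, ?_⟩
  have h := hv (QuotientGroup.mk γ)
  change zQf (QuotientGroup.mk γ) = τ (QuotientGroup.mk γ) v - v at h
  rw [hzQf_mk] at h
  change ((z.1 γ : W) : D) = _ at h
  rw [hzγ] at h
  exact h.symm

end Coinvariants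

end Literature.NumberTheory.GaloisRepresentations

end
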